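import Literature.Probability.Percolation.LongRangeSharpness
import Literature.Probability.Percolation.LongRangeKernelPercolationProofs
import Mathlib.Analysis.Complex.ExponentialBounds
import HarnessLib

/-!
# Long-range percolation on `ℤ^d`: the volume-tail bootstrap (Hutchcroft 2022, Cor. 1.4 from the two-ghost inequality)

Topic `Literature/Probability/Percolation`. Theorem-only file toward the named fact
`Hutchcroft2022_twoPoint_volumeTail` (§3 of the paper). It proves the deduction of Corollary 1.4
(volume tail) from Theorem 1.1 (two-point bound), Corollary 2.5 (`cβ_c ≤ β₁`) and the two-ghost
inequality (Theorem 3.1), all three entering as explicit hypotheses of `volumeTail_of_twoGhost`: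

* `exists_real_clusterSizeGe_le_div` — the a-priori bound `P_β(|K| ≥ n) ≤ χ/n` below `β_c` (Markov and
  sharpness), so that "`A(β) < ∞`";
* `sq_real_clusterSizeGe_le` — (3.3): `P_β(|K| ≥ n)² ≤ P_β(𝒮'_{x,n}) + P_β(0 ↔ x)` (translation
  invariance, Harris, union bound), and its average over `Λ_r`;
* `sum_real_twoLarge_le` — (3.4): Cauchy–Schwarz with the weights `e^{βJ_x} - 1 ≥ cβ r^{-d-α}`;
* `sq_real_clusterSizeGe_le_of_bounds` — (3.5);
* `exists_optimise_const` — the optimisation of `r` ((3.5)–(3.6));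
* **`volumeTail_of_twoGhost`** — the bootstrap on `A(β) = inf{A ≥ 1 : P_β(|K| ≥ n) ≤ A n^{-θ} ∀ n}`:
  `P_β(|K| ≥ n) ≤ A' (cβ)^{-d/(2d-α)} n^{-(d-α)/(2d)}` for `0 < β < β_c`, `n ≥ 1`.

Here `𝒮'_{x,n} = {|K(0)| ≥ n} ∩ {|K(x)| ≥ n} ∩ {0 ↮ x}` (below `β_c` all clusters are a.s. finite, so
the finiteness clause of the printed `𝒮'_{x,n}` is immaterial). Constants differ from the printed ones.

## References

* [Hutchcroft2022] T. Hutchcroft, J. Math. Phys. 63 (2022), arXiv:2202.07634, Corollary 1.4 and its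
  proof (§3, pp. 14–15), (3.3)–(3.6), Theorem 3.1 (statement).
* [Hutchcroft2021] T. Hutchcroft, arXiv:2008.11197, Thm. 3.1 (two-ghost inequality).
-/

noncomputable section

namespace Literature.Probability.Percolation

open Finset MeasureTheory Filter Topology Literature.Probability.LatticeModels
open scoped Literature.Probability.Percolation

variable {d : ℕ}

/-! ### Markov for counts, and the a-priori tail bound below `β_c` -/

section Apriori

/-- **Markov's inequality for a count of events**, sum form: at least `t > 0` of finitely many
events occur with probability `≤ (Σ_i P(E_i))/t`. [folklore] -/
theorem measureReal_count_ge_le_sum {Ω : Type*} [MeasurableSpace Ω] (μ : Measure Ω)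
    [IsProbabilityMeasure μ] {κ : Type*} (S : Finset κ) (E : κ → Set Ω)
    [∀ i ω, Decidable (ω ∈ E i)] (hE : ∀ i ∈ S, MeasurableSet (E i)) {t : ℝ} (ht : 0 < t) :
    μ.real {ω | t ≤ ((S.filter fun i => ω ∈ E i).card : ℝ)} ≤ (∑ i ∈ S, μ.real (E i)) / t := by
  classical
  set N : Ω → ℝ := fun ω => ∑ i ∈ S, (E i).indicator (fun _ => (1 : ℝ)) ω with hN
  have hNeq : ∀ ω, N ω = ((S.filter fun i => ω ∈ E i).card : ℝ) := by
    intro ω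
    simp only [hN, Set.indicator_apply, Finset.sum_boole]
  have hint : Integrable N μ :=
    integrable_finsetSum _ fun i hi => (integrable_const (1 : ℝ)).indicator (hE i hi)
  have hnn : 0 ≤ᵐ[μ] N := Filter.Eventually.of_forall fun ω =>
    Finset.sum_nonneg fun i _ => Set.indicator_nonneg (fun _ _ => zero_le_one) _
  have hmarkov := mul_meas_ge_le_integral_of_nonneg hnn hint t
  have hintegral : ∫ ω, N ω ∂μ = ∑ i ∈ S, μ.real (E i) := by
    rw [hN, integral_finsetSum _ fun i hi => (integrable_const (1 : ℝ)).indicator (hE i hi)]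
    exact Finset.sum_congr rfl fun i hi => by
      rw [integral_indicator_const _ (hE i hi), smul_eq_mul, mul_one]
  have hset : {ω | t ≤ ((S.filter fun i => ω ∈ E i).card : ℝ)} = {ω | t ≤ N ω} := by
    ext ω; rw [Set.mem_setOf_eq, Set.mem_setOf_eq, hNeq]
  rw [hset, le_div_iff₀ ht, mul_comm]
  rw [← hintegral]
  exact hmarkov

open Classical in
/-- `{|K(0)| ≥ n}` is the increasing union over boxes of "at least `n` points of the box are joined
to `0`". [folklore] -/
theorem clusterSizeGe_zero_eq_iUnion_box (n : ℕ) :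
    (clusterSizeGe (0 : Site d) n : Set (BondConfig (Site d))) =
      ⋃ R : ℕ, {ω | n ≤ ((box d R).filter fun y => (openGraph ω).Reachable 0 y).card} := by
  classical
  ext ω
  simp only [Set.mem_iUnion, Set.mem_setOf_eq]
  constructor
  · intro h
    rw [clusterSizeGe_eq_iUnion] at h
    simp only [Set.mem_iUnion, Set.mem_iInter, Subtype.exists, exists_prop] at h
    obtain ⟨F, hF, hconn⟩ := h
    -- a box containing `F`
    obtain ⟨R, hR⟩ : ∃ R : ℕ, ∀ y ∈ F, y ∈ box d R := by
      refine ⟨F.sup fun y => Finset.univ.sup fun i => (y i).natAbs, fun y hy => ?_⟩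
      rw [mem_box]
      intro i
      have h1 : (y i).natAbs ≤ Finset.univ.sup fun i => (y i).natAbs :=
        Finset.le_sup (f := fun i => (y i).natAbs) (Finset.mem_univ i)
      have h2 : (Finset.univ.sup fun i => (y i).natAbs) ≤ F.sup fun y => Finset.univ.sup fun i => (y i).natAbs :=
        Finset.le_sup (f := fun y => Finset.univ.sup fun i => (y i).natAbs) hy
      have h3 : (y i).natAbs ≤ F.sup fun y => Finset.univ.sup fun i => (y i).natAbs := h1.trans h2
      constructor <;> omega
    refine ⟨R, ?_⟩
    rw [← hF]
    exact Finset.card_le_card fun y hy => Finset.mem_filter.2 ⟨hR y hy, hconn y hy⟩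
  · rintro ⟨R, hR⟩
    rw [mem_clusterSizeGe]
    calc (n : ℕ∞) ≤ (((box d R).filter fun y => (openGraph ω).Reachable 0 y).card : ℕ∞) := by
          exact_mod_cast hR
      _ = (↑((box d R).filter fun y => (openGraph ω).Reachable 0 y) : Set (Site d)).encard :=
          (Set.encard_coe_eq_coe_finsetCard _).symm
      _ ≤ (openCluster ω 0).encard :=
          Set.encard_mono fun y hy => (Finset.mem_filter.1 (Finset.mem_coe.1 hy)).2

open Classical in
/-- **The a-priori volume tail below `β_c`**: `P_β(|K(0)| ≥ n) ≤ χ/n` with `χ = sup_Λ Σ_{y∈Λ} P_β(0 ↔ y) < ∞`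
(Markov's inequality and sharpness). [cite: Hutchcroft2022, §3 (p. 15, "which is finite by sharpness of the phase transition")] -/
theorem exists_real_clusterSizeGe_le_div {J : Sym2 (Site d) → ℝ} (hJ0 : ∀ e, 0 ≤ J e)
    (hT : IsTranslationInvariantKernel J) (hI : IsIntegrableKernel J) {β : ℝ} (hβ : 0 ≤ β)
    (hβc : β < kernelCriticalBeta J) :
    ∃ χ : ℝ, 0 ≤ χ ∧ ∀ n : ℕ, 1 ≤ n → (kernelPercolation J β).real (clusterSizeGe (0 : Site d) n) ≤ χ / n := by
  classical
  obtain ⟨C, hC⟩ := exists_sum_real_openConn_le_of_lt_criticalBeta hJ0 hT hI hβ hβc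
  have hC0 : 0 ≤ C := le_trans (by simp) (hC ∅ 0)
  refine ⟨C, hC0, fun n hn => ?_⟩
  set μ := kernelPercolation J β with hμ
  have hmono : Monotone fun R : ℕ => {ω : BondConfig (Site d) |
      n ≤ ((box d R).filter fun y => (openGraph ω).Reachable 0 y).card} := by
    intro R R' hRR' ω hω
    exact le_trans hω (Finset.card_le_card (Finset.filter_subset_filter _
      (fun x hx => by
        rw [mem_box] at hx ⊢
        intro i; have := hx i; constructor <;> omega)))
  have hlim := tendsto_measure_iUnion_atTop (μ := μ) hmono
  rw [← clusterSizeGe_zero_eq_iUnion_box n] at hlim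
  have hlim' : Tendsto (fun R : ℕ => μ.real {ω : BondConfig (Site d) |
      n ≤ ((box d R).filter fun y => (openGraph ω).Reachable 0 y).card}) atTop
      (𝓝 (μ.real (clusterSizeGe (0 : Site d) n))) :=
    (ENNReal.tendsto_toReal (measure_ne_top _ _)).comp hlim
  refine le_of_tendsto' hlim' fun R => ?_
  have hnpos : (0 : ℝ) < n := by exact_mod_cast hn
  have key := measureReal_count_ge_le_sum μ (box d R) (fun y => (openConn (0 : Site d) y : Set (BondConfig (Site d))))
    (fun y _ => measurableSet_openConn_holds 0 y) hnpos
  have hset : {ω : BondConfig (Site d) | n ≤ ((box d R).filter fun y => (openGraph ω).Reachable 0 y).card} ⊆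
      {ω | (n : ℝ) ≤ (((box d R).filter fun y => ω ∈ (openConn (0 : Site d) y : Set (BondConfig (Site d)))).card : ℝ)} := by
    intro ω hω
    simp only [Set.mem_setOf_eq] at hω ⊢
    exact_mod_cast hω
  calc μ.real _ ≤ μ.real _ := measureReal_mono hset (measure_ne_top _ _)
    _ ≤ (∑ y ∈ box d R, μ.real (openConn (0 : Site d) y)) / n := key
    _ ≤ C / n := div_le_div_of_nonneg_right (hC _ 0) hnpos.le

end Apriori

/-! ### The union bound (3.3) -/

section UnionBound

/-- `{|K(x)| ≥ n}` is increasing. [folklore] -/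
theorem isUpperSet_clusterSizeGe {V : Type*} (x : V) (n : ℕ) :
    IsUpperSet (clusterSizeGe x n : Set (BondConfig V)) := by
  intro ω ω' hle hω
  rw [mem_clusterSizeGe] at hω ⊢
  exact le_trans hω (Set.encard_mono fun y hy => hy.mono (openGraph_mono hle))

/-- **(3.3)**: `P_β(|K| ≥ n)² ≤ P_β(𝒮'_{x,n}) + P_β(0 ↔ x)`, where `𝒮'_{x,n}` is the event that `0`
and `x` lie in distinct clusters each with at least `n` vertices (translation invariance, Harris'
inequality and a union bound). [cite: Hutchcroft2022, proof of Cor. 1.4 (3.3)] -/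
theorem sq_real_clusterSizeGe_le {J : Sym2 (Site d) → ℝ} (hT : IsTranslationInvariantKernel J)
    (β : ℝ) (x : Site d) (n : ℕ) :
    (kernelPercolation J β).real (clusterSizeGe (0 : Site d) n) ^ 2 ≤
      (kernelPercolation J β).real (clusterSizeGe (0 : Site d) n ∩ clusterSizeGe x n ∩ (openConn (0 : Site d) x)ᶜ) +
        (kernelPercolation J β).real (openConn (0 : Site d) x) := by
  set μ := kernelPercolation J β with hμ
  have htrans : μ.real (clusterSizeGe x n) = μ.real (clusterSizeGe (0 : Site d) n) := by
    have := kernelPercolation_real_clusterSizeGe_add hT β (0 : Site d) x n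
    rw [zero_add] at this
    exact this
  have hharris : μ.real (clusterSizeGe (0 : Site d) n) * μ.real (clusterSizeGe x n) ≤
      μ.real (clusterSizeGe (0 : Site d) n ∩ clusterSizeGe x n) :=
    prodBernoulli_harris _ (isUpperSet_clusterSizeGe 0 n) (isUpperSet_clusterSizeGe x n)
      (measurableSet_clusterSizeGe 0 n) (measurableSet_clusterSizeGe x n)
  have hsub : (clusterSizeGe (0 : Site d) n ∩ clusterSizeGe x n : Set (BondConfig (Site d))) ⊆
      (clusterSizeGe (0 : Site d) n ∩ clusterSizeGe x n ∩ (openConn (0 : Site d) x)ᶜ) ∪ openConn (0 : Site d) x := by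
    intro ω hω
    by_cases h : ω ∈ (openConn (0 : Site d) x : Set (BondConfig (Site d)))
    · exact Or.inr h
    · exact Or.inl ⟨hω, h⟩
  calc μ.real (clusterSizeGe (0 : Site d) n) ^ 2
      = μ.real (clusterSizeGe (0 : Site d) n) * μ.real (clusterSizeGe x n) := by rw [sq, htrans]
    _ ≤ μ.real (clusterSizeGe (0 : Site d) n ∩ clusterSizeGe x n) := hharris
    _ ≤ μ.real ((clusterSizeGe (0 : Site d) n ∩ clusterSizeGe x n ∩ (openConn (0 : Site d) x)ᶜ) ∪ openConn (0 : Site d) x) :=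
        measureReal_mono hsub (measure_ne_top _ _)
    _ ≤ _ := measureReal_union_le _ _

/-- **(3.3) averaged over a box.** [cite: Hutchcroft2022, proof of Cor. 1.4 ("Averaging (3.3) over x ∈ Λ_r")] -/
theorem sq_real_clusterSizeGe_le_avg {J : Sym2 (Site d) → ℝ} (hT : IsTranslationInvariantKernel J)
    (β : ℝ) (n r : ℕ) :
    (kernelPercolation J β).real (clusterSizeGe (0 : Site d) n) ^ 2 ≤
      ((∑ x ∈ box d r, (kernelPercolation J β).real
          (clusterSizeGe (0 : Site d) n ∩ clusterSizeGe x n ∩ (openConn (0 : Site d) x)ᶜ)) +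
        ∑ x ∈ box d r, (kernelPercolation J β).real (openConn (0 : Site d) x)) / (box d r).card := by
  have hcard : (0 : ℝ) < (box d r).card := by rw [card_box]; positivity
  rw [le_div_iff₀ hcard, ← Finset.sum_add_distrib]
  calc (kernelPercolation J β).real (clusterSizeGe (0 : Site d) n) ^ 2 * (box d r).card
      = ∑ _x ∈ box d r, (kernelPercolation J β).real (clusterSizeGe (0 : Site d) n) ^ 2 := by
        rw [Finset.sum_const, nsmul_eq_mul, mul_comm]
    _ ≤ _ := Finset.sum_le_sum fun x _ => sq_real_clusterSizeGe_le hT β x n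

end UnionBound


/-! ### Cauchy–Schwarz over a box (3.4) -/

section CauchySchwarz

/-- `𝒮'_{0,n} = ∅`: `0` is joined to itself. [folklore] -/
theorem twoLarge_self_eq_empty (n : ℕ) :
    (clusterSizeGe (0 : Site d) n ∩ clusterSizeGe (0 : Site d) n ∩ (openConn (0 : Site d) 0)ᶜ :
      Set (BondConfig (Site d))) = ∅ :=
  Set.eq_empty_of_forall_notMem fun _ hω => hω.2 (SimpleGraph.Reachable.refl _)

/-- Points of `Λ_r` are at sup-distance at most `r` from `0`. [folklore] -/
theorem dist_zero_le_of_mem_box {r : ℕ} {x : Site d} (hx : x ∈ box d r) : dist (0 : Site d) x ≤ r := by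
  rw [dist_pi_le_iff (Nat.cast_nonneg r)]
  intro i
  rw [mem_box] at hx
  obtain ⟨h1, h2⟩ := hx i
  rw [Int.dist_eq]
  have h1' : (-(r : ℝ)) ≤ ((x i : ℤ) : ℝ) := by exact_mod_cast h1
  have h2' : ((x i : ℤ) : ℝ) ≤ r := by exact_mod_cast h2
  have h0 : (((0 : Site d) i : ℤ) : ℝ) = 0 := by simp
  rw [h0, zero_sub, abs_neg]
  exact abs_le.2 ⟨h1', h2'⟩

/-- For `x ∈ Λ_r ∖ {0}`: `e^{βJ_x} - 1 ≥ βJ_x ≥ cβ r^{-(d+α)}`. [cite: Hutchcroft2022, proof of Cor. 1.4 ("where we used that e^x - 1 ≥ x")] -/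
theorem exp_mul_kernel_sub_one_ge {J : Sym2 (Site d) → ℝ} {c α β : ℝ} (hc : 0 ≤ c) (hβ : 0 ≤ β)
    (hα : 0 ≤ (d : ℝ) + α) (hJ : HasPowerLowerBound J c α) {r : ℕ} {x : Site d} (hx : x ∈ box d r)
    (hx0 : x ≠ 0) :
    c * β * (r : ℝ) ^ (-((d : ℝ) + α)) ≤ Real.exp (β * J s(0, x)) - 1 := by
  have h1 : β * J s((0 : Site d), x) ≤ Real.exp (β * J s(0, x)) - 1 := by
    linarith [Real.add_one_le_exp (β * J s((0 : Site d), x))]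
  refine le_trans ?_ h1
  have hlow := hJ 0 x (Ne.symm hx0)
  have hdist_pos : 0 < dist (0 : Site d) x := dist_pos.2 (Ne.symm hx0)
  have hdist_le : dist (0 : Site d) x ≤ r := dist_zero_le_of_mem_box hx
  calc c * β * (r : ℝ) ^ (-((d : ℝ) + α)) ≤ c * β * (dist (0 : Site d) x) ^ (-((d : ℝ) + α)) := by
        apply mul_le_mul_of_nonneg_left _ (mul_nonneg hc hβ)
        exact Real.rpow_le_rpow_of_nonpos hdist_pos hdist_le (by linarith)
    _ = β * (c * (dist (0 : Site d) x) ^ (-((d : ℝ) + α))) := by ring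
    _ ≤ β * J s(0, x) := mul_le_mul_of_nonneg_left hlow hβ

/-- **(3.4)**: Cauchy–Schwarz over `Λ_r` with the weights `e^{βJ_x} - 1`:
`Σ_{x∈Λ_r} P(𝒮'_{x,n}) ≤ √B · √(|Λ_r| r^{d+α}/(cβ))` whenever `Σ_{x∈Λ_r} (e^{βJ_x}-1) P(𝒮'_{x,n})² ≤ B`.
[cite: Hutchcroft2022, proof of Cor. 1.4 (3.4)] -/
theorem sum_real_twoLarge_le {J : Sym2 (Site d) → ℝ} {c α β : ℝ} (hc : 0 < c) (hβ : 0 < β)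
    (hα : 0 ≤ (d : ℝ) + α) (hJ0 : ∀ e, 0 ≤ J e) (hJ : HasPowerLowerBound J c α) {r : ℕ} (hr : 1 ≤ r)
    {n : ℕ} {B : ℝ}
    (hB : ∑ x ∈ box d r, (Real.exp (β * J s(0, x)) - 1) *
        (kernelPercolation J β).real (clusterSizeGe (0 : Site d) n ∩ clusterSizeGe x n ∩ (openConn (0 : Site d) x)ᶜ) ^ 2 ≤ B) :
    ∑ x ∈ box d r, (kernelPercolation J β).real
        (clusterSizeGe (0 : Site d) n ∩ clusterSizeGe x n ∩ (openConn (0 : Site d) x)ᶜ) ≤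
      Real.sqrt B * Real.sqrt ((box d r).card * (r : ℝ) ^ ((d : ℝ) + α) / (c * β)) := by
  classical
  set μ := kernelPercolation J β with hμ
  set P : Site d → ℝ := fun x => μ.real (clusterSizeGe (0 : Site d) n ∩ clusterSizeGe x n ∩ (openConn (0 : Site d) x)ᶜ) with hP
  set g : Site d → ℝ := fun x => Real.exp (β * J s(0, x)) - 1 with hg
  have hP0 : P 0 = 0 := by simp only [hP]; rw [twoLarge_self_eq_empty, measureReal_empty]
  have hgnn : ∀ x, 0 ≤ g x := fun x => by
    simp only [hg, sub_nonneg]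
    exact Real.one_le_exp (mul_nonneg hβ.le (hJ0 _))
  have h0mem : (0 : Site d) ∈ box d r := by rw [mem_box]; intro i; simp
  have hcβ : 0 < c * β := mul_pos hc hβ
  have hrpos : (0 : ℝ) < r := by exact_mod_cast hr
  have hgpos : ∀ x ∈ (box d r).erase 0, 0 < g x := by
    intro x hx
    obtain ⟨hx0, hxb⟩ := Finset.mem_erase.1 hx
    exact lt_of_lt_of_le (by positivity) (exp_mul_kernel_sub_one_ge hc.le hβ.le hα hJ hxb hx0)
  have hginv : ∀ x ∈ (box d r).erase 0, 1 / g x ≤ (r : ℝ) ^ ((d : ℝ) + α) / (c * β) := by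
    intro x hx
    obtain ⟨hx0, hxb⟩ := Finset.mem_erase.1 hx
    have hlow := exp_mul_kernel_sub_one_ge hc.le hβ.le hα hJ hxb hx0
    have hpos : 0 < c * β * (r : ℝ) ^ (-((d : ℝ) + α)) := by positivity
    calc 1 / g x ≤ 1 / (c * β * (r : ℝ) ^ (-((d : ℝ) + α))) := one_div_le_one_div_of_le hpos hlow
      _ = (r : ℝ) ^ ((d : ℝ) + α) / (c * β) := by
          rw [Real.rpow_neg hrpos.le]; field_simp
  -- the sum without `0`
  have hsum : ∑ x ∈ box d r, P x = ∑ x ∈ (box d r).erase 0, P x := by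
    rw [← Finset.sum_erase_add _ _ h0mem, hP0, add_zero]
  show ∑ x ∈ box d r, P x ≤ _
  rw [hsum]
  -- Cauchy–Schwarz
  have hCS := Finset.sum_mul_sq_le_sq_mul_sq ((box d r).erase 0)
    (fun x => Real.sqrt (g x) * P x) (fun x => 1 / Real.sqrt (g x))
  have hprod : ∀ x ∈ (box d r).erase 0, Real.sqrt (g x) * P x * (1 / Real.sqrt (g x)) = P x := by
    intro x hx
    have := Real.sqrt_pos.2 (hgpos x hx)
    field_simp
  rw [Finset.sum_congr rfl hprod] at hCS
  have h1 : ∑ x ∈ (box d r).erase 0, (Real.sqrt (g x) * P x) ^ 2 ≤ B := by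
    calc ∑ x ∈ (box d r).erase 0, (Real.sqrt (g x) * P x) ^ 2 = ∑ x ∈ (box d r).erase 0, g x * P x ^ 2 :=
          Finset.sum_congr rfl fun x hx => by rw [mul_pow, Real.sq_sqrt (hgpos x hx).le]
      _ ≤ ∑ x ∈ box d r, g x * P x ^ 2 :=
          Finset.sum_le_sum_of_subset_of_nonneg (Finset.erase_subset _ _) fun x _ _ =>
            mul_nonneg (hgnn x) (sq_nonneg _)
      _ ≤ B := hB
  have h2 : ∑ x ∈ (box d r).erase 0, (1 / Real.sqrt (g x)) ^ 2 ≤ (box d r).card * (r : ℝ) ^ ((d : ℝ) + α) / (c * β) := by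
    calc ∑ x ∈ (box d r).erase 0, (1 / Real.sqrt (g x)) ^ 2 = ∑ x ∈ (box d r).erase 0, 1 / g x :=
          Finset.sum_congr rfl fun x hx => by rw [div_pow, one_pow, Real.sq_sqrt (hgpos x hx).le]
      _ ≤ ∑ _x ∈ (box d r).erase 0, (r : ℝ) ^ ((d : ℝ) + α) / (c * β) := Finset.sum_le_sum hginv
      _ = ((box d r).erase 0).card * ((r : ℝ) ^ ((d : ℝ) + α) / (c * β)) := by rw [Finset.sum_const, nsmul_eq_mul]
      _ ≤ (box d r).card * ((r : ℝ) ^ ((d : ℝ) + α) / (c * β)) := by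
          apply mul_le_mul_of_nonneg_right _ (by positivity)
          exact_mod_cast Finset.card_erase_le
      _ = _ := by ring
  have hB0 : 0 ≤ B := le_trans (Finset.sum_nonneg fun x _ => sq_nonneg _) h1
  have hS0 : 0 ≤ ∑ x ∈ (box d r).erase 0, P x := Finset.sum_nonneg fun x _ => measureReal_nonneg
  -- `(Σ P)² ≤ B · W` hence `Σ P ≤ √B √W`
  have hsq : (∑ x ∈ (box d r).erase 0, P x) ^ 2 ≤ B * ((box d r).card * (r : ℝ) ^ ((d : ℝ) + α) / (c * β)) :=
    hCS.trans (mul_le_mul h1 h2 (Finset.sum_nonneg fun _ _ => sq_nonneg _) hB0)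
  rw [← Real.sqrt_mul hB0, ← Real.sqrt_sq hS0]
  exact Real.sqrt_le_sqrt hsq

/-- **(3.5)**: for `n, r ≥ 1`, given the two-ghost bound `Σ_{x∈Λ_r} (e^{βJ_x}-1)P(𝒮'_{x,n})² ≤ B` and
the two-point bound `Σ_{x∈Λ_r} P(0 ↔ x) ≤ (A₂/(cβ)) r^α`,
`P_β(|K| ≥ n)² ≤ √B (cβ)^{-1/2} r^{α/2} + (A₂/(cβ)) r^{-(d-α)}`.
[cite: Hutchcroft2022, proof of Cor. 1.4 (3.5)] -/
theorem sq_real_clusterSizeGe_le_of_bounds {J : Sym2 (Site d) → ℝ} {c α β : ℝ} (hd : 1 ≤ d)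
    (hc : 0 < c) (hβ : 0 < β) (hα0 : 0 < α) (hJ0 : ∀ e, 0 ≤ J e) (hT : IsTranslationInvariantKernel J)
    (hJ : HasPowerLowerBound J c α) {r : ℕ} (hr : 1 ≤ r) {n : ℕ} {B A₂ : ℝ}
    (hB : ∑ x ∈ box d r, (Real.exp (β * J s(0, x)) - 1) *
        (kernelPercolation J β).real (clusterSizeGe (0 : Site d) n ∩ clusterSizeGe x n ∩ (openConn (0 : Site d) x)ᶜ) ^ 2 ≤ B)
    (h2 : ∑ x ∈ box d r, (kernelPercolation J β).real (openConn (0 : Site d) x) ≤ A₂ / (c * β) * (r : ℝ) ^ α) :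
    (kernelPercolation J β).real (clusterSizeGe (0 : Site d) n) ^ 2 ≤
      Real.sqrt B * (c * β) ^ (-(1 : ℝ) / 2) * (r : ℝ) ^ (α / 2) +
        A₂ / (c * β) * (r : ℝ) ^ (-((d : ℝ) - α)) := by
  have hα : 0 ≤ (d : ℝ) + α := by positivity
  have hcβ : 0 < c * β := mul_pos hc hβ
  have hrpos : (0 : ℝ) < r := by exact_mod_cast hr
  have hcard : ((box d r).card : ℝ) = (2 * (r : ℝ) + 1) ^ d := by rw [card_box]; push_cast; ring
  have hcardpos : (0 : ℝ) < (box d r).card := by rw [hcard]; positivity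
  have hcard_ge : (r : ℝ) ^ (d : ℝ) ≤ (box d r).card := by
    rw [hcard, Real.rpow_natCast]
    exact pow_le_pow_left₀ hrpos.le (by linarith) d
  have havg := sq_real_clusterSizeGe_le_avg hT β n r
  have hS := sum_real_twoLarge_le hc hβ hα hJ0 hJ hr hB (n := n)
  refine havg.trans ?_
  rw [add_div]
  refine add_le_add ?_ ?_
  · -- `√B √(|Λ| r^{d+α}/(cβ)) / |Λ| ≤ √B (cβ)^{-1/2} r^{α/2}`
    rw [div_le_iff₀ hcardpos]
    refine hS.trans ?_
    have hB0 : 0 ≤ Real.sqrt B := Real.sqrt_nonneg _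
    rw [mul_assoc, mul_assoc]
    apply mul_le_mul_of_nonneg_left _ hB0
    rw [← mul_assoc]
    -- `√(|Λ| r^{d+α}/(cβ)) ≤ (cβ)^{-1/2} r^{α/2} |Λ|`, i.e. `|Λ| r^{d+α}/(cβ) ≤ (cβ)^{-1} r^{α} |Λ|²`
    have hrhs : 0 ≤ (c * β) ^ (-(1 : ℝ) / 2) * (r : ℝ) ^ (α / 2) * (box d r).card := by positivity
    rw [← Real.sqrt_sq hrhs]
    apply Real.sqrt_le_sqrt
    have e1 : ((c * β) ^ (-(1 : ℝ) / 2) * (r : ℝ) ^ (α / 2) * (box d r).card) ^ 2 =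
        (c * β)⁻¹ * (r : ℝ) ^ α * ((box d r).card) ^ 2 := by
      have p1 : ((c * β) ^ (-(1 : ℝ) / 2)) ^ 2 = (c * β)⁻¹ := by
        rw [← Real.rpow_natCast, ← Real.rpow_mul hcβ.le,
          show (-(1 : ℝ) / 2 * ((2 : ℕ) : ℝ)) = -1 by norm_num, Real.rpow_neg_one]
      have p2 : ((r : ℝ) ^ (α / 2)) ^ 2 = (r : ℝ) ^ α := by
        rw [← Real.rpow_natCast, ← Real.rpow_mul hrpos.le]
        congr 1; push_cast; ring
      rw [mul_pow, mul_pow, p1, p2]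
    rw [e1]
    have e2 : (r : ℝ) ^ ((d : ℝ) + α) = (r : ℝ) ^ (d : ℝ) * (r : ℝ) ^ α := Real.rpow_add hrpos _ _
    rw [e2, div_eq_mul_inv]
    calc ((box d r).card : ℝ) * ((r : ℝ) ^ (d : ℝ) * (r : ℝ) ^ α) * (c * β)⁻¹
        ≤ (box d r).card * ((box d r).card * (r : ℝ) ^ α) * (c * β)⁻¹ := by
          apply mul_le_mul_of_nonneg_right _ (inv_nonneg.2 hcβ.le)
          apply mul_le_mul_of_nonneg_left _ hcardpos.le
          exact mul_le_mul_of_nonneg_right hcard_ge (by positivity)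
      _ = (c * β)⁻¹ * (r : ℝ) ^ α * ((box d r).card) ^ 2 := by ring
  · -- `(A₂/(cβ)) r^α / |Λ| ≤ (A₂/(cβ)) r^{-(d-α)}`
    rw [div_le_iff₀ hcardpos]
    refine h2.trans ?_
    have hA₂ : 0 ≤ A₂ / (c * β) * (r : ℝ) ^ α := by
      have : 0 ≤ ∑ x ∈ box d r, (kernelPercolation J β).real (openConn (0 : Site d) x) :=
        Finset.sum_nonneg fun _ _ => measureReal_nonneg
      exact this.trans h2
    have e3 : (r : ℝ) ^ α = (r : ℝ) ^ (-((d : ℝ) - α)) * (r : ℝ) ^ (d : ℝ) := by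
      rw [← Real.rpow_add hrpos]; congr 1; ring
    rcases le_or_gt 0 (A₂ / (c * β)) with hpos | hneg
    · rw [e3, ← mul_assoc]
      exact mul_le_mul_of_nonneg_left hcard_ge (by positivity)
    · -- `A₂ < 0` is impossible unless the sum vanishes; then both sides are handled by `hA₂`
      have : (r : ℝ) ^ α > 0 := Real.rpow_pos_of_pos hrpos α
      have : A₂ / (c * β) * (r : ℝ) ^ α < 0 := mul_neg_of_neg_of_pos hneg this
      linarith

end CauchySchwarz


/-! ### Optimising the radius -/

section Optimise

/-- **The optimisation over `r`** in the proof of Cor. 1.4: if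
`Ψ ≤ K₁ X^{-1/2} N^{-(d-α/2)/d} r^{α/2} + K₂ X^{-1} r^{-(d-α)}` for every integer `r ≥ 1`
(`0 < X < β₁`, `N ≥ 1`), then `Ψ ≤ (K₁ C + K₂) N^{-(d-α)/d} X^{-d/(2d-α)}` with `C = C(d,α,β₁)`
(take `r = ⌈N^{1/d} X^{-1/(2d-α)}⌉`, which is at least `β₁^{-1/(2d-α)}`, "rounding up a number that
is bounded away from zero increases that number by at most a bounded multiplicative factor").
[cite: Hutchcroft2022, proof of Cor. 1.4 (3.5)–(3.6)] -/
theorem exists_optimise_const (hd : 1 ≤ d) {α : ℝ} (hα0 : 0 < α) (hαd : α < d) {β₁ : ℝ} :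
    ∃ C : ℝ, 0 < C ∧ ∀ (X N K₁ K₂ Ψ : ℝ), 0 < X → X < β₁ → 1 ≤ N → 0 ≤ K₁ → 0 ≤ K₂ →
      (∀ r : ℕ, 1 ≤ r → Ψ ≤ K₁ * X ^ (-(1 : ℝ) / 2) * N ^ (-(((d : ℝ) - α / 2) / d)) * (r : ℝ) ^ (α / 2) +
        K₂ * X⁻¹ * (r : ℝ) ^ (-((d : ℝ) - α))) →
      Ψ ≤ (K₁ * C + K₂) * N ^ (-(((d : ℝ) - α) / d)) * X ^ (-((d : ℝ) / (2 * d - α))) := by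
  have hdpos : (0 : ℝ) < d := by exact_mod_cast (by omega : 0 < d)
  set κ : ℝ := (d : ℝ) - α / 2 with hκ
  have hκpos : 0 < κ := by rw [hκ]; linarith
  -- `ρ₀ = β₁^{-1/(2κ)}`, `C₄ = 1 + 1/ρ₀`
  set ρ₀ : ℝ := Real.exp (-(Real.log β₁ / (2 * κ))) with hρ₀
  have hρ₀pos : 0 < ρ₀ := Real.exp_pos _
  set C₄ : ℝ := 1 + 1 / ρ₀ with hC₄
  have hC₄pos : 0 < C₄ := by positivity
  refine ⟨Real.exp (Real.log C₄ * (α / 2)), Real.exp_pos _, ?_⟩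
  intro X N K₁ K₂ Ψ hX hXβ hN hK₁ hK₂ h
  have hNpos : 0 < N := by linarith
  set Lx := Real.log X with hLx
  set Ln := Real.log N with hLn
  have hLn0 : 0 ≤ Ln := Real.log_nonneg hN
  have hLxle : Lx ≤ Real.log β₁ := Real.log_le_log hX hXβ.le
  -- the radius
  set ρ : ℝ := Real.exp (Ln / d - Lx / (2 * κ)) with hρ
  have hρpos : 0 < ρ := Real.exp_pos _
  have hρge : ρ₀ ≤ ρ := by
    rw [hρ₀, hρ]
    apply Real.exp_le_exp.2
    have h1 : 0 ≤ Ln / d := div_nonneg hLn0 hdpos.le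
    have h2 : Lx / (2 * κ) ≤ Real.log β₁ / (2 * κ) := div_le_div_of_nonneg_right hLxle (by positivity)
    linarith
  set r : ℕ := ⌈ρ⌉₊ with hr
  have hr1 : 1 ≤ r := Nat.one_le_iff_ne_zero.2 (Nat.pos_iff_ne_zero.1 (Nat.ceil_pos.2 hρpos))
  have hrge : ρ ≤ r := Nat.le_ceil ρ
  have hrle : (r : ℝ) ≤ C₄ * ρ := by
    have h1 : (r : ℝ) < ρ + 1 := Nat.ceil_lt_add_one hρpos.le
    have h2 : ρ + 1 ≤ C₄ * ρ := by
      rw [hC₄, add_mul, one_mul, add_le_add_iff_left, div_mul_eq_mul_div, one_mul, le_div_iff₀ hρ₀pos]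
      simpa using hρge
    linarith
  have hrpos : (0 : ℝ) < r := lt_of_lt_of_le hρpos hrge
  have hmain := h r hr1
  -- bounds on the two `r`-terms
  have hb1 : (r : ℝ) ^ (α / 2) ≤ (C₄ * ρ) ^ (α / 2) := Real.rpow_le_rpow hrpos.le hrle (by linarith)
  have hb2 : (r : ℝ) ^ (-((d : ℝ) - α)) ≤ ρ ^ (-((d : ℝ) - α)) :=
    Real.rpow_le_rpow_of_nonpos hρpos hrge (by linarith)
  -- everything as exponentials of linear forms in `Ln, Lx`
  have eX : ∀ t : ℝ, X ^ t = Real.exp (Lx * t) := fun t => by rw [Real.rpow_def_of_pos hX, hLx]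
  have eN : ∀ t : ℝ, N ^ t = Real.exp (Ln * t) := fun t => by rw [Real.rpow_def_of_pos hNpos, hLn]
  have eρ : ∀ t : ℝ, ρ ^ t = Real.exp ((Ln / d - Lx / (2 * κ)) * t) := fun t => by
    rw [hρ, ← Real.exp_mul]
  have eC : (C₄ * ρ) ^ (α / 2) = Real.exp (Real.log C₄ * (α / 2)) * ρ ^ (α / 2) := by
    rw [Real.mul_rpow hC₄pos.le hρpos.le, Real.rpow_def_of_pos hC₄pos]
  have hXinv : X⁻¹ = Real.exp (Lx * (-1)) := by rw [← eX, Real.rpow_neg_one]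
  have hdne : (d : ℝ) ≠ 0 := hdpos.ne'
  have h2ne : (2 : ℝ) * (d : ℝ) - α ≠ 0 := by linarith
  have h2ne' : (d : ℝ) * 2 - α ≠ 0 := by linarith
  have hκne : κ ≠ 0 := hκpos.ne'
  -- the two identities
  have I4 : X ^ (-(1 : ℝ) / 2) * N ^ (-(((d : ℝ) - α / 2) / d)) * ρ ^ (α / 2) =
      N ^ (-(((d : ℝ) - α) / d)) * X ^ (-((d : ℝ) / (2 * d - α))) := by
    rw [eX, eN, eρ, eN, eX, ← Real.exp_add, ← Real.exp_add, ← Real.exp_add]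
    congr 1
    rw [hκ]
    field_simp
    ring
  have I5 : X⁻¹ * ρ ^ (-((d : ℝ) - α)) = N ^ (-(((d : ℝ) - α) / d)) * X ^ (-((d : ℝ) / (2 * d - α))) := by
    rw [hXinv, eρ, eN, eX, ← Real.exp_add, ← Real.exp_add]
    congr 1
    rw [hκ]
    field_simp
    ring
  -- assemble
  have hT1 : K₁ * X ^ (-(1 : ℝ) / 2) * N ^ (-(((d : ℝ) - α / 2) / d)) * (r : ℝ) ^ (α / 2) ≤
      K₁ * Real.exp (Real.log C₄ * (α / 2)) * (N ^ (-(((d : ℝ) - α) / d)) * X ^ (-((d : ℝ) / (2 * d - α)))) := by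
    calc K₁ * X ^ (-(1 : ℝ) / 2) * N ^ (-(((d : ℝ) - α / 2) / d)) * (r : ℝ) ^ (α / 2)
        ≤ K₁ * X ^ (-(1 : ℝ) / 2) * N ^ (-(((d : ℝ) - α / 2) / d)) * (C₄ * ρ) ^ (α / 2) :=
          mul_le_mul_of_nonneg_left hb1 (by positivity)
      _ = K₁ * Real.exp (Real.log C₄ * (α / 2)) * (X ^ (-(1 : ℝ) / 2) * N ^ (-(((d : ℝ) - α / 2) / d)) * ρ ^ (α / 2)) := by
          rw [eC]; ring
      _ = _ := by rw [I4]
  have hT2 : K₂ * X⁻¹ * (r : ℝ) ^ (-((d : ℝ) - α)) ≤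
      K₂ * (N ^ (-(((d : ℝ) - α) / d)) * X ^ (-((d : ℝ) / (2 * d - α)))) := by
    calc K₂ * X⁻¹ * (r : ℝ) ^ (-((d : ℝ) - α)) ≤ K₂ * X⁻¹ * ρ ^ (-((d : ℝ) - α)) :=
          mul_le_mul_of_nonneg_left hb2 (by positivity)
      _ = K₂ * (X⁻¹ * ρ ^ (-((d : ℝ) - α))) := by ring
      _ = _ := by rw [I5]
  calc Ψ ≤ _ := hmain
    _ ≤ K₁ * Real.exp (Real.log C₄ * (α / 2)) * (N ^ (-(((d : ℝ) - α) / d)) * X ^ (-((d : ℝ) / (2 * d - α)))) +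
          K₂ * (N ^ (-(((d : ℝ) - α) / d)) * X ^ (-((d : ℝ) / (2 * d - α)))) := add_le_add hT1 hT2
    _ = _ := by ring

end Optimise


/-! ### The bootstrap (Cor. 1.4 from Thm. 1.1, Cor. 2.5 and the two-ghost inequality) -/

section Bootstrap

/-- Elementary: `1 ≤ u`, `u² ≤ 1 + b u` (`b ≥ 0`) imply `u² ≤ 2 b² + 2`. [folklore] -/
theorem sq_le_of_sq_le_one_add_mul {u b : ℝ} (hu : 1 ≤ u) (hb : 0 ≤ b) (h : u ^ 2 ≤ 1 + b * u) :
    u ^ 2 ≤ 2 * b ^ 2 + 2 := by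
  have hu' : u ≤ b + 1 := by
    by_contra hcon
    push Not at hcon
    nlinarith
  nlinarith

/-- **Corollary 1.4 of Hutchcroft 2022, subcritical form, from the two-ghost inequality**: for
`d ≥ 1`, `0 < α < d` and constants `A₂, β₁, C_tg`, there is `A' = A'(d,α,A₂,β₁,C_tg)` such that for
every kernel `J` (translation invariant, integrable, `J ≥ c‖x-y‖^{-d-α}`) satisfying, for all
`0 < β < β_c`, the two-point bound `Σ_{x∈Λ_r} P_β(0 ↔ x) ≤ (A₂/(cβ)) r^α` (Thm. 1.1), the bound
`cβ < β₁` (Cor. 2.5) and the two-ghost inequality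
`Σ_{x∈Λ_r} (e^{βJ_x}-1) P_β(𝒮'_{x,n})² ≤ C_tg A²/((1-2θ)² n^{1+2θ})` whenever `P_β(|K| ≥ n) ≤ A n^{-θ}`
(Thm. 3.1), one has `P_β(|K| ≥ n) ≤ A' (cβ)^{-d/(2d-α)} n^{-(d-α)/(2d)}` for all `0 < β < β_c`,
`n ≥ 1`. Proof as printed: (3.3) by Harris and a union bound, (3.4) by Cauchy–Schwarz, (3.5),
optimisation of `r`, and the bootstrap on `A(β) = min{A ≥ 1 : P_β(|K| ≥ n) ≤ A n^{-θ} ∀n}` (finite by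
sharpness). [cite: Hutchcroft2022, Corollary 1.4 and its proof (§3, pp. 14–15)] -/
theorem volumeTail_of_twoGhost (hd : 1 ≤ d) {α : ℝ} (hα0 : 0 < α) (hαd : α < d)
    {A₂ β₁ Ctg : ℝ} (hA₂ : 0 < A₂) (hβ₁ : 0 < β₁) (hCtg : 0 < Ctg) :
    ∃ A' : ℝ, 0 < A' ∧ ∀ (J : Sym2 (Site d) → ℝ) (c : ℝ), 0 < c → (∀ e, 0 ≤ J e) →
      IsTranslationInvariantKernel J → IsIntegrableKernel J → HasPowerLowerBound J c α →
      (∀ β : ℝ, 0 < β → β < kernelCriticalBeta J → ∀ r : ℕ, 1 ≤ r →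
          ∑ x ∈ box d r, (kernelPercolation J β).real (openConn (0 : Site d) x) ≤ A₂ / (c * β) * (r : ℝ) ^ α) →
      (∀ β : ℝ, 0 < β → β < kernelCriticalBeta J → c * β < β₁) →
      (∀ β : ℝ, 0 < β → β < kernelCriticalBeta J → ∀ (A θ : ℝ), 1 ≤ A → 0 ≤ θ → θ < 1 / 2 →
          (∀ n : ℕ, 1 ≤ n → (kernelPercolation J β).real (clusterSizeGe (0 : Site d) n) ≤ A * (n : ℝ) ^ (-θ)) →
          ∀ n : ℕ, 1 ≤ n → ∀ r : ℕ, ∑ x ∈ box d r, (Real.exp (β * J s(0, x)) - 1) *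
              (kernelPercolation J β).real
                (clusterSizeGe (0 : Site d) n ∩ clusterSizeGe x n ∩ (openConn (0 : Site d) x)ᶜ) ^ 2 ≤
            Ctg * A ^ 2 / ((1 - 2 * θ) ^ 2 * (n : ℝ) ^ (1 + 2 * θ))) →
      ∀ β : ℝ, 0 < β → β < kernelCriticalBeta J → ∀ n : ℕ, 1 ≤ n →
        (kernelPercolation J β).real (clusterSizeGe (0 : Site d) n) ≤
          A' / (c * β) ^ ((d : ℝ) / (2 * d - α)) * (n : ℝ) ^ (-((d : ℝ) - α) / (2 * d)) := by
  have hdpos : (0 : ℝ) < d := by exact_mod_cast (by omega : 0 < d)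
  -- exponents
  set θ : ℝ := ((d : ℝ) - α) / (2 * d) with hθ
  have hθ0 : 0 ≤ θ := by rw [hθ]; exact div_nonneg (by linarith) (by positivity)
  have hθhalf : θ < 1 / 2 := by
    rw [hθ, div_lt_iff₀ (by positivity)]; linarith
  have h12θ : 0 < 1 - 2 * θ := by linarith
  set s : ℝ := (d : ℝ) / (2 * d - α) with hs
  have h2dα : 0 < 2 * (d : ℝ) - α := by linarith
  have hspos : 0 < s := div_pos hdpos h2dα
  set κ : ℝ := (d : ℝ) - α / 2 with hκ
  have hκpos : 0 < κ := by rw [hκ]; linarith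
  -- constants
  obtain ⟨C, hC, hopt⟩ := exists_optimise_const (d := d) hd hα0 hαd (β₁ := β₁)
  set c₁ : ℝ := Real.sqrt Ctg / (1 - 2 * θ) with hc₁
  have hc₁pos : 0 < c₁ := div_pos (Real.sqrt_pos.2 hCtg) h12θ
  set c₂ : ℝ := max (c₁ * C) A₂ with hc₂
  have hc₂pos : 0 < c₂ := lt_max_of_lt_right hA₂
  set C₀ : ℝ := Real.sqrt c₂ with hC₀
  have hC₀pos : 0 < C₀ := Real.sqrt_pos.2 hc₂pos
  set A' : ℝ := 4 * C₀ ^ 2 + 2 * β₁ ^ s with hA'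
  have hA'pos : 0 < A' := by positivity
  refine ⟨A', hA'pos, ?_⟩
  intro J c hc hJ0 hT hI hJ h2pt hb1 h2g β hβ hβc n hn
  have hcβ : 0 < c * β := mul_pos hc hβ
  set X : ℝ := c * β with hX
  have hXβ : X < β₁ := hb1 β hβ hβc
  set μ := kernelPercolation J β with hμ
  set P : ℕ → ℝ := fun m => μ.real (clusterSizeGe (0 : Site d) m) with hP
  have hP0 : ∀ m, 0 ≤ P m := fun m => measureReal_nonneg
  have hP1 : ∀ m, P m ≤ 1 := fun m => measureReal_le_one
  -- Step 1: the bootstrap implication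
  have hstep : ∀ A : ℝ, 1 ≤ A → (∀ m : ℕ, 1 ≤ m → P m ≤ A * (m : ℝ) ^ (-θ)) →
      ∀ m : ℕ, 1 ≤ m → P m ≤ C₀ * Real.sqrt (A + 1) * X ^ (-(s / 2)) * (m : ℝ) ^ (-θ) := by
    intro A hA htail m hm
    have hmpos : (0 : ℝ) < m := by exact_mod_cast hm
    have hA0 : 0 ≤ A := by linarith
    set K₁ : ℝ := c₁ * A with hK₁
    have hK₁0 : 0 ≤ K₁ := by positivity
    -- `B = (K₁ m^{-κ/d})²`
    have hBeq : Ctg * A ^ 2 / ((1 - 2 * θ) ^ 2 * (m : ℝ) ^ (1 + 2 * θ)) = (K₁ * (m : ℝ) ^ (-(κ / d))) ^ 2 := by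
      have e1 : ((m : ℝ) ^ (-(κ / d))) ^ 2 = ((m : ℝ) ^ (1 + 2 * θ))⁻¹ := by
        rw [← Real.rpow_natCast, ← Real.rpow_mul hmpos.le, ← Real.rpow_neg hmpos.le]
        congr 1
        rw [hκ, hθ]; push_cast; field_simp; ring
      rw [mul_pow, e1, hK₁, mul_pow, hc₁, div_pow, Real.sq_sqrt hCtg.le]
      have : (1 - 2 * θ) ^ 2 ≠ 0 := by positivity
      have : (m : ℝ) ^ (1 + 2 * θ) ≠ 0 := (Real.rpow_pos_of_pos hmpos _).ne'
      field_simp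
    have hΨ : ∀ r : ℕ, 1 ≤ r → P m ^ 2 ≤ K₁ * X ^ (-(1 : ℝ) / 2) * (m : ℝ) ^ (-(((d : ℝ) - α / 2) / d)) * (r : ℝ) ^ (α / 2) +
        A₂ * X⁻¹ * (r : ℝ) ^ (-((d : ℝ) - α)) := by
      intro r hr
      have hB := h2g β hβ hβc A θ hA hθ0 hθhalf htail m hm r
      rw [hBeq] at hB
      have h35 := sq_real_clusterSizeGe_le_of_bounds hd hc hβ hα0 hJ0 hT hJ hr hB (h2pt β hβ hβc r hr)
      have hsqrt : Real.sqrt ((K₁ * (m : ℝ) ^ (-(κ / d))) ^ 2) = K₁ * (m : ℝ) ^ (-(κ / d)) :=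
        Real.sqrt_sq (by positivity)
      rw [hsqrt] at h35
      have hκd : -(κ / (d : ℝ)) = -(((d : ℝ) - α / 2) / d) := by rw [hκ]
      rw [hκd] at h35
      calc P m ^ 2 ≤ _ := h35
        _ = _ := by rw [← hX, div_eq_mul_inv A₂ X]; ring
    have hopt' := hopt X m K₁ A₂ (P m ^ 2) hcβ hXβ (by exact_mod_cast hm) hK₁0 hA₂.le hΨ
    -- `P² ≤ c₂ (A+1) m^{-2θ'} X^{-s}`
    have hc₂bd : K₁ * C + A₂ ≤ c₂ * (A + 1) := by
      rw [hK₁]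
      calc c₁ * A * C + A₂ = (c₁ * C) * A + A₂ * 1 := by ring
        _ ≤ c₂ * A + c₂ * 1 := add_le_add (mul_le_mul_of_nonneg_right (le_max_left _ _) hA0)
            (mul_le_mul_of_nonneg_right (le_max_right _ _) zero_le_one)
        _ = c₂ * (A + 1) := by ring
    have hpow0 : 0 ≤ (m : ℝ) ^ (-(((d : ℝ) - α) / d)) * X ^ (-((d : ℝ) / (2 * d - α))) := by positivity
    have hsq : P m ^ 2 ≤ c₂ * (A + 1) * ((m : ℝ) ^ (-(((d : ℝ) - α) / d)) * X ^ (-((d : ℝ) / (2 * d - α)))) := by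
      calc P m ^ 2 ≤ _ := hopt'
        _ = (K₁ * C + A₂) * ((m : ℝ) ^ (-(((d : ℝ) - α) / d)) * X ^ (-((d : ℝ) / (2 * d - α)))) := by ring
        _ ≤ _ := mul_le_mul_of_nonneg_right hc₂bd hpow0
    -- take square roots
    have e2 : Real.sqrt ((m : ℝ) ^ (-(((d : ℝ) - α) / d))) = (m : ℝ) ^ (-θ) := by
      rw [Real.sqrt_eq_rpow, ← Real.rpow_mul hmpos.le]; congr 1; rw [hθ]; field_simp
    have e3 : Real.sqrt (X ^ (-((d : ℝ) / (2 * d - α)))) = X ^ (-(s / 2)) := by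
      rw [Real.sqrt_eq_rpow, ← Real.rpow_mul hcβ.le]; congr 1; rw [hs]; ring
    calc P m = Real.sqrt (P m ^ 2) := (Real.sqrt_sq (hP0 m)).symm
      _ ≤ Real.sqrt (c₂ * (A + 1) * ((m : ℝ) ^ (-(((d : ℝ) - α) / d)) * X ^ (-((d : ℝ) / (2 * d - α))))) :=
          Real.sqrt_le_sqrt hsq
      _ = C₀ * Real.sqrt (A + 1) * X ^ (-(s / 2)) * (m : ℝ) ^ (-θ) := by
          rw [Real.sqrt_mul (by positivity), Real.sqrt_mul hc₂pos.le, Real.sqrt_mul (by positivity), e2, e3, hC₀]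
          ring
  -- Step 2: the set of admissible constants is nonempty (sharpness) and closed
  obtain ⟨χ, hχ0, hχ⟩ := exists_real_clusterSizeGe_le_div hJ0 hT hI hβ.le hβc
  set 𝒜 : Set ℝ := {A | 1 ≤ A ∧ ∀ m : ℕ, 1 ≤ m → P m ≤ A * (m : ℝ) ^ (-θ)} with h𝒜
  have h𝒜ne : 𝒜.Nonempty := by
    refine ⟨max 1 χ, le_max_left _ _, fun m hm => ?_⟩
    have hmpos : (0 : ℝ) < m := by exact_mod_cast hm
    have hm1 : (1 : ℝ) ≤ m := by exact_mod_cast hm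
    calc P m ≤ χ / m := hχ m hm
      _ = χ * (m : ℝ) ^ (-(1 : ℝ)) := by rw [Real.rpow_neg_one, div_eq_mul_inv]
      _ ≤ χ * (m : ℝ) ^ (-θ) := by
          apply mul_le_mul_of_nonneg_left _ hχ0
          exact Real.rpow_le_rpow_of_exponent_le hm1 (by linarith)
      _ ≤ max 1 χ * (m : ℝ) ^ (-θ) := mul_le_mul_of_nonneg_right (le_max_right _ _) (by positivity)
  have h𝒜bdd : BddBelow 𝒜 := ⟨1, fun A hA => hA.1⟩
  set Astar := sInf 𝒜 with hAstar
  have hAstar1 : 1 ≤ Astar := le_csInf h𝒜ne fun A hA => hA.1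
  have hAstar_mem : ∀ m : ℕ, 1 ≤ m → P m ≤ Astar * (m : ℝ) ^ (-θ) := by
    intro m hm
    have hmpos : (0 : ℝ) < m := by exact_mod_cast hm
    have hpow : 0 < (m : ℝ) ^ (-θ) := Real.rpow_pos_of_pos hmpos _
    rw [← div_le_iff₀ hpow]
    exact le_csInf h𝒜ne fun A hA => (div_le_iff₀ hpow).2 (hA.2 m hm)
  -- Step 3: apply the implication at `A*`
  have hf := hstep Astar hAstar1 hAstar_mem
  set f : ℝ := C₀ * Real.sqrt (Astar + 1) * X ^ (-(s / 2)) with hfdef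
  have hf0 : 0 ≤ f := by positivity
  have hmax_mem : max 1 f ∈ 𝒜 := by
    refine ⟨le_max_left _ _, fun m hm => (hf m hm).trans ?_⟩
    exact mul_le_mul_of_nonneg_right (le_max_right _ _) (by positivity)
  have hAle : Astar ≤ max 1 f := csInf_le h𝒜bdd hmax_mem
  have hAle' : Astar ≤ 1 + f := hAle.trans (max_le (by linarith) (by linarith))
  -- Step 4: solve the inequality `A* ≤ 1 + C₀ X^{-s/2} √(A*+1)`
  set b : ℝ := Real.sqrt 2 * C₀ * X ^ (-(s / 2)) with hb
  have hb0 : 0 ≤ b := by positivity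
  set u : ℝ := Real.sqrt Astar with hu
  have hu1 : 1 ≤ u := by rw [hu]; exact Real.one_le_sqrt.2 hAstar1
  have husq : u ^ 2 = Astar := Real.sq_sqrt (by linarith)
  have hineq : u ^ 2 ≤ 1 + b * u := by
    rw [husq]
    refine hAle'.trans ?_
    rw [hfdef, hb]
    have hsq2 : Real.sqrt (Astar + 1) ≤ Real.sqrt 2 * u := by
      rw [hu, ← Real.sqrt_mul (by norm_num)]
      exact Real.sqrt_le_sqrt (by linarith)
    have := mul_le_mul_of_nonneg_left hsq2 (show 0 ≤ C₀ * X ^ (-(s / 2)) by positivity)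
    nlinarith [this]
  have hAbound : Astar ≤ 2 * b ^ 2 + 2 := by rw [← husq]; exact sq_le_of_sq_le_one_add_mul hu1 hb0 hineq
  -- `2 b² + 2 ≤ A' X^{-s}`
  have hXs : X ^ (-s) = (X ^ s)⁻¹ := Real.rpow_neg hcβ.le s
  have hbsq : b ^ 2 = 2 * C₀ ^ 2 * X ^ (-s) := by
    rw [hb, mul_pow, mul_pow, Real.sq_sqrt (by norm_num), ← Real.rpow_natCast (X ^ (-(s/2))) 2,
      ← Real.rpow_mul hcβ.le]
    congr 1; congr 1; push_cast; ring
  have hone : (1 : ℝ) ≤ β₁ ^ s * X ^ (-s) := by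
    rw [hXs, ← div_eq_mul_inv, le_div_iff₀ (Real.rpow_pos_of_pos hcβ s), one_mul]
    exact Real.rpow_le_rpow hcβ.le hXβ.le hspos.le
  have hAfin : Astar ≤ A' * X ^ (-s) := by
    calc Astar ≤ 2 * b ^ 2 + 2 := hAbound
      _ = 4 * C₀ ^ 2 * X ^ (-s) + 2 * 1 := by rw [hbsq]; ring
      _ ≤ 4 * C₀ ^ 2 * X ^ (-s) + 2 * (β₁ ^ s * X ^ (-s)) := by linarith [hone]
      _ = A' * X ^ (-s) := by rw [hA']; ring
  -- conclude
  have hmain := hAstar_mem n hn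
  have hnpos : (0 : ℝ) < n := by exact_mod_cast hn
  calc μ.real (clusterSizeGe (0 : Site d) n) = P n := rfl
    _ ≤ Astar * (n : ℝ) ^ (-θ) := hmain
    _ ≤ A' * X ^ (-s) * (n : ℝ) ^ (-θ) := mul_le_mul_of_nonneg_right hAfin (by positivity)
    _ = A' / (c * β) ^ ((d : ℝ) / (2 * d - α)) * (n : ℝ) ^ (-((d : ℝ) - α) / (2 * d)) := by
        rw [hXs, ← div_eq_mul_inv, hX, hs, hθ, neg_div]

end Bootstrap


end Literature.Probability.Percolation

end
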